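import Literature.NumberTheory.EllipticCurves.CMBranchDualReductionCaseCRing
import Literature.NumberTheory.EllipticCurves.CMBranchDualReductionCaseBRing

/-!
# CM-branch reduction of the `Λ`-dual of the Betina–Dimitrov weight-one CM Hecke algebras — cases (gen)/(B)
# («Lemma T», kernel form, continued)

Pure commutative algebra, sorry-free, no facts. Context and honesty statement: module docstring of
`CMBranchDualReductionCaseC.lean`; the ring `𝒯 = Λ ×_k k⟦Y₂⟧ ×_k k⟦Y₃⟧ ×_k Λ` (`Y_i^{e_i} = X`, ANY
`e₂, e₃ ≥ 1`, so the generic case `e = 1` and case (B) `e ≥ 2` of [BD, Thm 2] at once) and its coordinates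
`V Λ n₂ n₃`: `CMBranchDualReductionCaseBRing.lean`.

WHAT IS PROVED (kernel). With `ω = Module.Dual Λ (V Λ n₂ n₃)`, `t·f = f ∘ₗ mulLeft t`,
`pOmega 𝔭 = span{t·f : t ∈ 𝔭}`: for `𝔭 = ker pr₁` (the CM branch `π_ψ`, first factor) AND for
`𝔭' = ker pr₄` (`(c;a;b;d) ↦ c + Xd`, the conjugate CM branch, last factor),
`ω ⧸ pOmega ≃ₗ[Λ] Λ/(X) × Λ/(X) × Λ` (`dualQuotEquiv₁`, `dualQuotEquiv₄`; comparison maps `φ₁ f =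
(f(Y₂^{e₂}) mod X, f(Y₃^{e₃}) mod X, f(vec₃))`, `φ₄ f = (…, …, f(m₄))`, `vec₃ = -X·1 + Y₂^{e₂} + Y₃^{e₃} + m₄`
spanning `Ann(𝔭)`), hence over a domain `X • (ω/𝔭ω)_tors = 0` (`smul_eq_zero_of_mem_torsion₁/₄`). This is
reader 1's computation `ω_𝒯/𝔭ω_𝒯 = Λw ⊕ k(τ₂' - u₂″w) ⊕ k(τ₃' - u₃″w) ≅ Λ ⊕ k²` (ADD-5 §2, (gen)/(B)) for
EVERY `e` (the exact-arithmetic companion `r1-lemmaT/check_lemmaT_pure.py` covered `e ≤ 3`; referee C4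
C4-R3.2(d)(iii) checked (gen)/(B) «at argument level»). What stays on paper: as in `…CaseC.lean` (BD's ring
identification [cite: BetinaDimitrov2021, Thm 2 / Thm 4.8]; BSTW's `T⁻ ≅ ω_𝒯 ⊗_𝒯 𝒯/𝔭`, arXiv:2409.01350v2
Part I Prop. 4.12, PREPRINT). Nothing here bears on any census cell.
-/

namespace Literature.NumberTheory.EllipticCurves.IwasawaTransfer

open Submodule Module

namespace BDRingB

section DualB

variable {Λ : Type*} [CommRing Λ] (X : Λ) (n₂ n₃ : ℕ)

/-- Two functionals agreeing on the basis `1, Y₂^(i+1), Y₃^(j+1), m₄` are equal. [folklore] -/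
private theorem dual_ext {f g : Module.Dual Λ (V Λ n₂ n₃)} (h1 : f (one n₂ n₃) = g (one n₂ n₃))
    (h2 : ∀ i, f (y₂ n₂ n₃ i) = g (y₂ n₂ n₃ i)) (h3 : ∀ j, f (y₃ n₂ n₃ j) = g (y₃ n₂ n₃ j))
    (h4 : f (m₄ n₂ n₃) = g (m₄ n₂ n₃)) : f = g := by
  refine LinearMap.prod_ext (LinearMap.ext_ring ?_) (LinearMap.prod_ext
    (LinearMap.pi_ext' fun i => LinearMap.ext_ring ?_) (LinearMap.prod_ext
    (LinearMap.pi_ext' fun j => LinearMap.ext_ring ?_) (LinearMap.ext_ring ?_)))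
  · change f (one n₂ n₃) = g (one n₂ n₃)
    exact h1
  · change f (y₂ n₂ n₃ i) = g (y₂ n₂ n₃ i)
    exact h2 i
  · change f (y₃ n₂ n₃ j) = g (y₃ n₂ n₃ j)
    exact h3 j
  · change f (m₄ n₂ n₃) = g (m₄ n₂ n₃)
    exact h4

/-- `𝔭·ω ⊆ ω = Hom_Λ(𝒯, Λ)`: the `Λ`-span of the functionals `t·f = f ∘ (t·_)`, `t ∈ 𝔭`, `f ∈ ω`.
[cite: BurungaleSkinnerTianWan2024, Part I Prop. 4.12 (proof l.3385–3388 `Sat-prop2`: repair step Lemma T = r1 ADD-5 §2; PREPRINT)] -/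
def pOmega (𝔭 : Submodule Λ (V Λ n₂ n₃)) : Submodule Λ (Module.Dual Λ (V Λ n₂ n₃)) :=
  span Λ {g | ∃ t ∈ 𝔭, ∃ f : Module.Dual Λ (V Λ n₂ n₃), f ∘ₗ mulLeft X n₂ n₃ t = g}

/-- The functional `(c; a; b; d) ↦ α·a₀ + Σ_{i<n₂} f(Y₂^(i+1))·a_{i+1}`. [folklore] -/
private def F₂ (f : Module.Dual Λ (V Λ n₂ n₃)) (α : Λ) : Module.Dual Λ (V Λ n₂ n₃) :=
  α • (LinearMap.proj 0 ∘ₗ blkA n₂ n₃) +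
    ∑ i : Fin n₂, f (y₂ n₂ n₃ (Fin.castSucc i)) • (LinearMap.proj i.succ ∘ₗ blkA n₂ n₃)

/-- The functional `(c; a; b; d) ↦ β·b₀ + Σ_{j<n₃} f(Y₃^(j+1))·b_{j+1}`. [folklore] -/
private def F₃ (f : Module.Dual Λ (V Λ n₂ n₃)) (β : Λ) : Module.Dual Λ (V Λ n₂ n₃) :=
  β • (LinearMap.proj 0 ∘ₗ blkB n₂ n₃) +
    ∑ j : Fin n₃, f (y₃ n₂ n₃ (Fin.castSucc j)) • (LinearMap.proj j.succ ∘ₗ blkB n₂ n₃)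

/-- Unfolding `F₂`. [folklore] -/
private theorem F₂_apply (f : Module.Dual Λ (V Λ n₂ n₃)) (α : Λ) (v : V Λ n₂ n₃) :
    F₂ n₂ n₃ f α v = α * v.2.1 0 + ∑ i : Fin n₂, f (y₂ n₂ n₃ (Fin.castSucc i)) * v.2.1 i.succ := by
  simp [F₂, LinearMap.sum_apply]

/-- Unfolding `F₃`. [folklore] -/
private theorem F₃_apply (f : Module.Dual Λ (V Λ n₂ n₃)) (β : Λ) (v : V Λ n₂ n₃) :
    F₃ n₂ n₃ f β v = β * v.2.2.1 0 + ∑ j : Fin n₃, f (y₃ n₂ n₃ (Fin.castSucc j)) * v.2.2.1 j.succ := by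
  simp [F₃, LinearMap.sum_apply]

/-- `F₂ (Y₂ · Y₂^(i+1)) = f(Y₂^(i+1))`. [folklore] -/
private theorem F₂_shift (f : Module.Dual Λ (V Λ n₂ n₃)) (α : Λ) (hα : f (y₂ n₂ n₃ (Fin.last n₂)) = X * α)
    (i : Fin (n₂ + 1)) : F₂ n₂ n₃ f α (0, shift X n₂ (Pi.single i 1), 0, 0) = f (y₂ n₂ n₃ i) := by
  rcases Fin.eq_castSucc_or_eq_last i with ⟨i₀, rfl⟩ | rfl
  · rw [shift_single_castSucc, F₂_apply]
    simp [Pi.single_apply, Fin.succ_ne_zero, Finset.sum_ite_eq']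
  · rw [shift_single_last, F₂_apply, hα]
    simp [Fin.succ_ne_zero, mul_comm]

/-- `F₃ (Y₃ · Y₃^(j+1)) = f(Y₃^(j+1))`. [folklore] -/
private theorem F₃_shift (f : Module.Dual Λ (V Λ n₂ n₃)) (β : Λ) (hβ : f (y₃ n₂ n₃ (Fin.last n₃)) = X * β)
    (j : Fin (n₃ + 1)) : F₃ n₂ n₃ f β (0, 0, shift X n₃ (Pi.single j 1), 0) = f (y₃ n₂ n₃ j) := by
  rcases Fin.eq_castSucc_or_eq_last j with ⟨j₀, rfl⟩ | rfl
  · rw [shift_single_castSucc, F₃_apply]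
    simp [Pi.single_apply, Fin.succ_ne_zero, Finset.sum_ite_eq']
  · rw [shift_single_last, F₃_apply, hβ]
    simp [Fin.succ_ne_zero, mul_comm]

/-! #### Branch 1: `𝔭 = ker π_ψ` (projection onto the FIRST factor `Λ`) -/

/-- Comparison map `ω → Λ/(X) × Λ/(X) × Λ`, `f ↦ (f(Y₂^e₂) mod X, f(Y₃^e₃) mod X, f(vec₃))`.
[cite: BurungaleSkinnerTianWan2024, Part I Prop. 4.12 (proof l.3385–3388 `Sat-prop2`: repair step Lemma T = r1 ADD-5 §2; PREPRINT)] -/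
def φ₁ : Module.Dual Λ (V Λ n₂ n₃) →ₗ[Λ] (Λ ⧸ Ideal.span {X}) × (Λ ⧸ Ideal.span {X}) × Λ :=
  ((Ideal.span {X}).mkQ ∘ₗ LinearMap.applyₗ (y₂ n₂ n₃ (Fin.last n₂))).prod
    (((Ideal.span {X}).mkQ ∘ₗ LinearMap.applyₗ (y₃ n₂ n₃ (Fin.last n₃))).prod
      (LinearMap.applyₗ (vec₃ X n₂ n₃)))

/-- Unfolding `φ₁`. [folklore] -/
@[simp] private theorem φ₁_apply (f : Module.Dual Λ (V Λ n₂ n₃)) : φ₁ X n₂ n₃ f =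
    ((Ideal.span {X}).mkQ (f (y₂ n₂ n₃ (Fin.last n₂))), (Ideal.span {X}).mkQ (f (y₃ n₂ n₃ (Fin.last n₃))),
      f (vec₃ X n₂ n₃)) := rfl

/-- A functional with `X ∣ g(Y₂^e₂)`, `X ∣ g(Y₃^e₃)`, `g(vec₃) = 0` lies in `ker φ₁`. [folklore] -/
private theorem φ₁_eq_zero_of {g : Module.Dual Λ (V Λ n₂ n₃)} (h2 : X ∣ g (y₂ n₂ n₃ (Fin.last n₂)))
    (h3 : X ∣ g (y₃ n₂ n₃ (Fin.last n₃))) (hv : g (vec₃ X n₂ n₃) = 0) : φ₁ X n₂ n₃ g = 0 := by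
  have h2' : (Ideal.span {X}).mkQ (g (y₂ n₂ n₃ (Fin.last n₂))) = 0 :=
    (Submodule.Quotient.mk_eq_zero _).mpr (Ideal.mem_span_singleton.mpr h2)
  have h3' : (Ideal.span {X}).mkQ (g (y₃ n₂ n₃ (Fin.last n₃))) = 0 :=
    (Submodule.Quotient.mk_eq_zero _).mpr (Ideal.mem_span_singleton.mpr h3)
  rw [φ₁_apply, h2', h3', hv]
  rfl

/-- (branch 1) `𝔭ω ⊆ ker φ₁`.
[cite: BurungaleSkinnerTianWan2024, Part I Prop. 4.12 (proof l.3385–3388 `Sat-prop2`: repair step Lemma T = r1 ADD-5 §2; PREPRINT)] -/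
theorem pOmega_ker_pr₁_le : pOmega X n₂ n₃ (LinearMap.ker (pr₁ n₂ n₃)) ≤ LinearMap.ker (φ₁ X n₂ n₃) := by
  refine span_le.mpr ?_
  rintro g ⟨t, ht, f, rfl⟩
  rw [LinearMap.mem_ker, pr₁_apply] at ht
  rw [SetLike.mem_coe, LinearMap.mem_ker]
  refine φ₁_eq_zero_of X n₂ n₃ ?_ ?_ ?_
  · rw [LinearMap.comp_apply, mulLeft_y₂_last, ht, zero_smul, zero_add]
    refine ⟨f (0, t.2.1, 0, 0), ?_⟩
    rw [← smul_eq_mul, ← map_smul]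
    congr 1
    ext <;> simp
  · rw [LinearMap.comp_apply, mulLeft_y₃_last, ht, zero_smul, zero_add]
    refine ⟨f (0, 0, t.2.2.1, 0), ?_⟩
    rw [← smul_eq_mul, ← map_smul]
    congr 1
    ext <;> simp
  · rw [LinearMap.comp_apply, mulLeft_vec₃ X n₂ n₃ t ht, map_zero]

/-- (branch 1) `ker φ₁ ⊆ 𝔭ω`: `f = Y₂·F₂ + Y₃·F₃ + m₄·((f(1)-α-β)·lst)`.
[cite: BurungaleSkinnerTianWan2024, Part I Prop. 4.12 (proof l.3385–3388 `Sat-prop2`: repair step Lemma T = r1 ADD-5 §2; PREPRINT)] -/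
theorem ker_φ₁_le_pOmega : LinearMap.ker (φ₁ X n₂ n₃) ≤ pOmega X n₂ n₃ (LinearMap.ker (pr₁ n₂ n₃)) := by
  intro f hf
  rw [LinearMap.mem_ker, φ₁_apply, Prod.mk_eq_zero, Prod.mk_eq_zero] at hf
  obtain ⟨h2, h3, hv⟩ := hf
  obtain ⟨α, hα⟩ := Ideal.mem_span_singleton.mp ((Submodule.Quotient.mk_eq_zero _).mp h2)
  obtain ⟨β, hβ⟩ := Ideal.mem_span_singleton.mp ((Submodule.Quotient.mk_eq_zero _).mp h3)
  rw [vec₃_eq, map_add, map_add, map_add, map_smul, hα, hβ, smul_eq_mul] at hv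
  have hm₄ : f (m₄ n₂ n₃) = X * (f (one n₂ n₃) - α - β) := by linear_combination hv
  have hf : f = F₂ n₂ n₃ f α ∘ₗ mulLeft X n₂ n₃ (y₂ n₂ n₃ 0) + F₃ n₂ n₃ f β ∘ₗ mulLeft X n₂ n₃ (y₃ n₂ n₃ 0)
      + ((f (one n₂ n₃) - α - β) • lst n₂ n₃) ∘ₗ mulLeft X n₂ n₃ (m₄ n₂ n₃) := by
    refine dual_ext n₂ n₃ ?_ (fun i => ?_) (fun j => ?_) ?_
    · simp only [LinearMap.add_apply, LinearMap.comp_apply, mulLeft_one, LinearMap.smul_apply,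
        lst_apply, F₂_apply, F₃_apply, y₂, y₃, m₄]
      simp [Fin.succ_ne_zero]
    · rw [LinearMap.add_apply, LinearMap.add_apply, LinearMap.comp_apply, LinearMap.comp_apply,
        LinearMap.comp_apply, mulLeft_y₂_zero_y₂, mulLeft_y₃_zero_y₂, mulLeft_m₄_y₂, map_zero, map_zero,
        add_zero, add_zero, F₂_shift X n₂ n₃ f α hα]
    · rw [LinearMap.add_apply, LinearMap.add_apply, LinearMap.comp_apply, LinearMap.comp_apply,
        LinearMap.comp_apply, mulLeft_y₂_zero_y₃, mulLeft_y₃_zero_y₃, mulLeft_m₄_y₃, map_zero, map_zero,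
        zero_add, add_zero, F₃_shift X n₂ n₃ f β hβ]
    · rw [hm₄]
      simp only [LinearMap.add_apply, LinearMap.comp_apply, mulLeft_m₄, LinearMap.smul_apply, lst_apply,
        F₂_apply, F₃_apply]
      simp [y₂, y₃, m₄]
      ring
  rw [hf]
  refine add_mem (add_mem (subset_span ⟨y₂ n₂ n₃ 0, ?_, _, rfl⟩) (subset_span ⟨y₃ n₂ n₃ 0, ?_, _, rfl⟩))
    (subset_span ⟨m₄ n₂ n₃, ?_, _, rfl⟩)
  · rw [LinearMap.mem_ker, pr₁_apply, y₂]
  · rw [LinearMap.mem_ker, pr₁_apply, y₃]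
  · rw [LinearMap.mem_ker, pr₁_apply, m₄]

/-- (branch 1) `φ₁` is surjective.
[cite: BurungaleSkinnerTianWan2024, Part I Prop. 4.12 (proof l.3385–3388 `Sat-prop2`: repair step Lemma T = r1 ADD-5 §2; PREPRINT)] -/
theorem φ₁_surjective : Function.Surjective (φ₁ X n₂ n₃) := by
  rintro ⟨q₁, q₂, z⟩
  obtain ⟨x, rfl⟩ := (Ideal.span {X}).mkQ_surjective q₁
  obtain ⟨y, rfl⟩ := (Ideal.span {X}).mkQ_surjective q₂
  refine ⟨x • (LinearMap.proj (Fin.last n₂) ∘ₗ blkA n₂ n₃) + y • (LinearMap.proj (Fin.last n₃) ∘ₗ blkB n₂ n₃)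
    + (z - x - y) • lst n₂ n₃, ?_⟩
  rw [φ₁_apply]
  refine Prod.ext ?_ (Prod.ext ?_ ?_)
  · simp [y₂]
  · simp [y₃]
  · simp [vec₃]

/-- (branch 1) `𝔭ω = ker φ₁`.
[cite: BurungaleSkinnerTianWan2024, Part I Prop. 4.12 (proof l.3385–3388 `Sat-prop2`: repair step Lemma T = r1 ADD-5 §2; PREPRINT)] -/
theorem pOmega_ker_pr₁_eq : pOmega X n₂ n₃ (LinearMap.ker (pr₁ n₂ n₃)) = LinearMap.ker (φ₁ X n₂ n₃) :=
  le_antisymm (pOmega_ker_pr₁_le X n₂ n₃) (ker_φ₁_le_pOmega X n₂ n₃)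

/-- **Lemma T, cases (gen)/(B), branch `ker π_ψ`** (kernel form): for BD's ring
`𝒯 = Λ ×_k k⟦Y₂⟧ ×_k k⟦Y₃⟧ ×_k Λ` (`Y_i^(e_i) = X`, any `e₂, e₃ ≥ 1`) and `𝔭` the kernel of the projection
onto the first factor, `ω_𝒯/𝔭ω_𝒯 ≅ Λ/(X) ⊕ Λ/(X) ⊕ Λ` as `Λ`-modules.
[cite: BurungaleSkinnerTianWan2024, Part I Prop. 4.12 (proof l.3385–3388 `Sat-prop2`: repair step Lemma T = r1 ADD-5 §2; PREPRINT)] -/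
noncomputable def dualQuotEquiv₁ :
    (Module.Dual Λ (V Λ n₂ n₃) ⧸ pOmega X n₂ n₃ (LinearMap.ker (pr₁ n₂ n₃))) ≃ₗ[Λ]
      (Λ ⧸ Ideal.span {X}) × (Λ ⧸ Ideal.span {X}) × Λ :=
  (Submodule.quotEquivOfEq _ _ (pOmega_ker_pr₁_eq X n₂ n₃)).trans
    ((φ₁ X n₂ n₃).quotKerEquivOfSurjective (φ₁_surjective X n₂ n₃))

/-- **Lemma T ((gen)/(B), branch `π_ψ`), the form Lemma S consumes**: `X` kills the torsion of `ω_𝒯/𝔭ω_𝒯` (`Λ` a domain).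
[cite: BurungaleSkinnerTianWan2024, Part I Prop. 4.12 (proof l.3385–3388 `Sat-prop2`: repair step Lemma T = r1 ADD-5 §2; PREPRINT)] -/
theorem smul_eq_zero_of_mem_torsion₁ [IsDomain Λ]
    (y : Module.Dual Λ (V Λ n₂ n₃) ⧸ pOmega X n₂ n₃ (LinearMap.ker (pr₁ n₂ n₃)))
    (hy : y ∈ torsion Λ (Module.Dual Λ (V Λ n₂ n₃) ⧸ pOmega X n₂ n₃ (LinearMap.ker (pr₁ n₂ n₃)))) :
    X • y = 0 :=
  smul_eq_zero_of_mem_torsion_of_equiv X (dualQuotEquiv₁ X n₂ n₃) hy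

/-! #### Branch 4: `𝔭' = ker` of the projection onto the LAST factor `Λ` (`(c; a; b; d) ↦ c + dX`) -/

/-- The projection onto the last factor `Λ` (the other CM branch): `(c; a; b; d) ↦ c + X d`.
[cite: BetinaDimitrov2021, Thm 2 (= Thm 4.8 (i)), cases r = 2] -/
def pr₄ : V Λ n₂ n₃ →ₗ[Λ] Λ := pr₁ n₂ n₃ + X • lst n₂ n₃

/-- Unfolding `pr₄`. [cite: BetinaDimitrov2021, Thm 2 (= Thm 4.8 (i)), cases r = 2] -/
@[simp] theorem pr₄_apply (v : V Λ n₂ n₃) : pr₄ X n₂ n₃ v = v.1 + X * v.2.2.2 := rfl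

/-- Comparison map for branch 4: `f ↦ (f(Y₂^e₂) mod X, f(Y₃^e₃) mod X, f(m₄))`.
[cite: BurungaleSkinnerTianWan2024, Part I Prop. 4.12 (proof l.3385–3388 `Sat-prop2`: repair step Lemma T = r1 ADD-5 §2; PREPRINT)] -/
def φ₄ : Module.Dual Λ (V Λ n₂ n₃) →ₗ[Λ] (Λ ⧸ Ideal.span {X}) × (Λ ⧸ Ideal.span {X}) × Λ :=
  ((Ideal.span {X}).mkQ ∘ₗ LinearMap.applyₗ (y₂ n₂ n₃ (Fin.last n₂))).prod
    (((Ideal.span {X}).mkQ ∘ₗ LinearMap.applyₗ (y₃ n₂ n₃ (Fin.last n₃))).prod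
      (LinearMap.applyₗ (m₄ n₂ n₃)))

/-- Unfolding `φ₄`. [folklore] -/
@[simp] private theorem φ₄_apply (f : Module.Dual Λ (V Λ n₂ n₃)) : φ₄ X n₂ n₃ f =
    ((Ideal.span {X}).mkQ (f (y₂ n₂ n₃ (Fin.last n₂))), (Ideal.span {X}).mkQ (f (y₃ n₂ n₃ (Fin.last n₃))),
      f (m₄ n₂ n₃)) := rfl

/-- A functional with `X ∣ g(Y₂^e₂)`, `X ∣ g(Y₃^e₃)`, `g(m₄) = 0` lies in `ker φ₄`. [folklore] -/
private theorem φ₄_eq_zero_of {g : Module.Dual Λ (V Λ n₂ n₃)} (h2 : X ∣ g (y₂ n₂ n₃ (Fin.last n₂)))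
    (h3 : X ∣ g (y₃ n₂ n₃ (Fin.last n₃))) (hv : g (m₄ n₂ n₃) = 0) : φ₄ X n₂ n₃ g = 0 := by
  have h2' : (Ideal.span {X}).mkQ (g (y₂ n₂ n₃ (Fin.last n₂))) = 0 :=
    (Submodule.Quotient.mk_eq_zero _).mpr (Ideal.mem_span_singleton.mpr h2)
  have h3' : (Ideal.span {X}).mkQ (g (y₃ n₂ n₃ (Fin.last n₃))) = 0 :=
    (Submodule.Quotient.mk_eq_zero _).mpr (Ideal.mem_span_singleton.mpr h3)
  rw [φ₄_apply, h2', h3', hv]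
  rfl

/-- (branch 4) `𝔭'ω ⊆ ker φ₄`.
[cite: BurungaleSkinnerTianWan2024, Part I Prop. 4.12 (proof l.3385–3388 `Sat-prop2`: repair step Lemma T = r1 ADD-5 §2; PREPRINT)] -/
theorem pOmega_ker_pr₄_le : pOmega X n₂ n₃ (LinearMap.ker (pr₄ X n₂ n₃)) ≤ LinearMap.ker (φ₄ X n₂ n₃) := by
  refine span_le.mpr ?_
  rintro g ⟨t, ht, f, rfl⟩
  rw [LinearMap.mem_ker, pr₄_apply] at ht
  have ht' : t.1 = -(X * t.2.2.2) := eq_neg_of_add_eq_zero_left ht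
  rw [SetLike.mem_coe, LinearMap.mem_ker]
  refine φ₄_eq_zero_of X n₂ n₃ ?_ ?_ ?_
  · rw [LinearMap.comp_apply, mulLeft_y₂_last, ht']
    have e : ((0 : Λ), -(X * t.2.2.2) • Pi.single (Fin.last n₂) (1 : Λ) + X • t.2.1,
        (0 : Fin (n₃ + 1) → Λ), (0 : Λ)) =
        X • ((0 : Λ), t.2.1 - t.2.2.2 • Pi.single (Fin.last n₂) (1 : Λ), (0 : Fin (n₃ + 1) → Λ), (0 : Λ)) := by
      ext <;> simp only [Prod.smul_mk, smul_zero, Pi.add_apply, Pi.smul_apply, Pi.sub_apply, smul_eq_mul]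
        <;> ring
    exact ⟨f (0, t.2.1 - t.2.2.2 • Pi.single (Fin.last n₂) 1, 0, 0), by rw [e, map_smul, smul_eq_mul]⟩
  · rw [LinearMap.comp_apply, mulLeft_y₃_last, ht']
    have e : ((0 : Λ), (0 : Fin (n₂ + 1) → Λ), -(X * t.2.2.2) • Pi.single (Fin.last n₃) (1 : Λ) + X • t.2.2.1,
        (0 : Λ)) =
        X • ((0 : Λ), (0 : Fin (n₂ + 1) → Λ), t.2.2.1 - t.2.2.2 • Pi.single (Fin.last n₃) (1 : Λ), (0 : Λ)) := by
      ext <;> simp only [Prod.smul_mk, smul_zero, Pi.add_apply, Pi.smul_apply, Pi.sub_apply, smul_eq_mul]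
        <;> ring
    exact ⟨f (0, 0, t.2.2.1 - t.2.2.2 • Pi.single (Fin.last n₃) 1, 0), by rw [e, map_smul, smul_eq_mul]⟩
  · rw [LinearMap.comp_apply, mulLeft_m₄, ht, ← Prod.zero_eq_mk, ← Prod.zero_eq_mk, ← Prod.zero_eq_mk,
      map_zero]

/-- (branch 4) `ker φ₄ ⊆ 𝔭'ω`: `f = Y₂·F₂ + Y₃·F₃ + vec₃·((f(1)-α-β)·lst)`.
[cite: BurungaleSkinnerTianWan2024, Part I Prop. 4.12 (proof l.3385–3388 `Sat-prop2`: repair step Lemma T = r1 ADD-5 §2; PREPRINT)] -/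
theorem ker_φ₄_le_pOmega : LinearMap.ker (φ₄ X n₂ n₃) ≤ pOmega X n₂ n₃ (LinearMap.ker (pr₄ X n₂ n₃)) := by
  intro f hf
  rw [LinearMap.mem_ker, φ₄_apply, Prod.mk_eq_zero, Prod.mk_eq_zero] at hf
  obtain ⟨h2, h3, hm⟩ := hf
  obtain ⟨α, hα⟩ := Ideal.mem_span_singleton.mp ((Submodule.Quotient.mk_eq_zero _).mp h2)
  obtain ⟨β, hβ⟩ := Ideal.mem_span_singleton.mp ((Submodule.Quotient.mk_eq_zero _).mp h3)
  have hf : f = F₂ n₂ n₃ f α ∘ₗ mulLeft X n₂ n₃ (y₂ n₂ n₃ 0) + F₃ n₂ n₃ f β ∘ₗ mulLeft X n₂ n₃ (y₃ n₂ n₃ 0)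
      + ((f (one n₂ n₃) - α - β) • lst n₂ n₃) ∘ₗ mulLeft X n₂ n₃ (vec₃ X n₂ n₃) := by
    refine dual_ext n₂ n₃ ?_ (fun i => ?_) (fun j => ?_) ?_
    · simp only [LinearMap.add_apply, LinearMap.comp_apply, mulLeft_one, LinearMap.smul_apply,
        lst_apply, F₂_apply, F₃_apply, y₂, y₃, vec₃]
      simp [Fin.succ_ne_zero]
    · rw [LinearMap.add_apply, LinearMap.add_apply, LinearMap.comp_apply, LinearMap.comp_apply,
        LinearMap.comp_apply, mulLeft_y₂_zero_y₂, mulLeft_y₃_zero_y₂, mulLeft_vec₃_y₂, map_zero, map_zero,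
        add_zero, add_zero, F₂_shift X n₂ n₃ f α hα]
    · rw [LinearMap.add_apply, LinearMap.add_apply, LinearMap.comp_apply, LinearMap.comp_apply,
        LinearMap.comp_apply, mulLeft_y₂_zero_y₃, mulLeft_y₃_zero_y₃, mulLeft_vec₃_y₃, map_zero, map_zero,
        zero_add, add_zero, F₃_shift X n₂ n₃ f β hβ]
    · rw [hm]
      simp only [LinearMap.add_apply, LinearMap.comp_apply, mulLeft_m₄, LinearMap.smul_apply, lst_apply,
        F₂_apply, F₃_apply]
      simp [y₂, y₃, vec₃]
  rw [hf]
  refine add_mem (add_mem (subset_span ⟨y₂ n₂ n₃ 0, ?_, _, rfl⟩) (subset_span ⟨y₃ n₂ n₃ 0, ?_, _, rfl⟩))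
    (subset_span ⟨vec₃ X n₂ n₃, ?_, _, rfl⟩)
  · rw [LinearMap.mem_ker, pr₄_apply, y₂]; simp
  · rw [LinearMap.mem_ker, pr₄_apply, y₃]; simp
  · rw [LinearMap.mem_ker, pr₄_apply, vec₃]; simp

/-- (branch 4) `φ₄` is surjective.
[cite: BurungaleSkinnerTianWan2024, Part I Prop. 4.12 (proof l.3385–3388 `Sat-prop2`: repair step Lemma T = r1 ADD-5 §2; PREPRINT)] -/
theorem φ₄_surjective : Function.Surjective (φ₄ X n₂ n₃) := by
  rintro ⟨q₁, q₂, z⟩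
  obtain ⟨x, rfl⟩ := (Ideal.span {X}).mkQ_surjective q₁
  obtain ⟨y, rfl⟩ := (Ideal.span {X}).mkQ_surjective q₂
  refine ⟨x • (LinearMap.proj (Fin.last n₂) ∘ₗ blkA n₂ n₃) + y • (LinearMap.proj (Fin.last n₃) ∘ₗ blkB n₂ n₃)
    + z • lst n₂ n₃, ?_⟩
  rw [φ₄_apply]
  refine Prod.ext ?_ (Prod.ext ?_ ?_)
  · simp [y₂]
  · simp [y₃]
  · simp [m₄]

/-- (branch 4) `𝔭'ω = ker φ₄`.
[cite: BurungaleSkinnerTianWan2024, Part I Prop. 4.12 (proof l.3385–3388 `Sat-prop2`: repair step Lemma T = r1 ADD-5 §2; PREPRINT)] -/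
theorem pOmega_ker_pr₄_eq : pOmega X n₂ n₃ (LinearMap.ker (pr₄ X n₂ n₃)) = LinearMap.ker (φ₄ X n₂ n₃) :=
  le_antisymm (pOmega_ker_pr₄_le X n₂ n₃) (ker_φ₄_le_pOmega X n₂ n₃)

/-- **Lemma T, cases (gen)/(B), branch 4** (kernel form): same ring, `𝔭'` the kernel of the projection
onto the LAST factor `Λ` (the conjugate CM branch); again `ω_𝒯/𝔭'ω_𝒯 ≅ Λ/(X) ⊕ Λ/(X) ⊕ Λ`.
[cite: BurungaleSkinnerTianWan2024, Part I Prop. 4.12 (proof l.3385–3388 `Sat-prop2`: repair step Lemma T = r1 ADD-5 §2; PREPRINT)] -/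
noncomputable def dualQuotEquiv₄ :
    (Module.Dual Λ (V Λ n₂ n₃) ⧸ pOmega X n₂ n₃ (LinearMap.ker (pr₄ X n₂ n₃))) ≃ₗ[Λ]
      (Λ ⧸ Ideal.span {X}) × (Λ ⧸ Ideal.span {X}) × Λ :=
  (Submodule.quotEquivOfEq _ _ (pOmega_ker_pr₄_eq X n₂ n₃)).trans
    ((φ₄ X n₂ n₃).quotKerEquivOfSurjective (φ₄_surjective X n₂ n₃))

/-- **Lemma T ((gen)/(B), conjugate branch), the form Lemma S consumes**: `X` kills the torsion of `ω_𝒯/𝔭'ω_𝒯` (`Λ` a domain).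
[cite: BurungaleSkinnerTianWan2024, Part I Prop. 4.12 (proof l.3385–3388 `Sat-prop2`: repair step Lemma T = r1 ADD-5 §2; PREPRINT)] -/
theorem smul_eq_zero_of_mem_torsion₄ [IsDomain Λ]
    (y : Module.Dual Λ (V Λ n₂ n₃) ⧸ pOmega X n₂ n₃ (LinearMap.ker (pr₄ X n₂ n₃)))
    (hy : y ∈ torsion Λ (Module.Dual Λ (V Λ n₂ n₃) ⧸ pOmega X n₂ n₃ (LinearMap.ker (pr₄ X n₂ n₃)))) :
    X • y = 0 :=
  smul_eq_zero_of_mem_torsion_of_equiv X (dualQuotEquiv₄ X n₂ n₃) hy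

end DualB

end BDRingB

end Literature.NumberTheory.EllipticCurves.IwasawaTransfer
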